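import Literature.AlgebraicGeometry.Motives.AbelianVarietyQuotientAction
import Literature.AlgebraicGeometry.RelativeSpec.FreeQuotient
import HarnessLib

/-!
# The action of `S ⋊ Aut(L/K)` on `P_L` over `P` is free

Continuation of `Literature.AlgebraicGeometry.Motives.AbelianVarietyQuotientAction`. For an abelian
variety `P` over a field `K`, a field extension `L / K`, a Galois-stable subgroup `S ≤ P(L)` and a
homomorphism `q : P → P` killing `S` (an isogeny in the application, e.g. `q = [m]` and
`S ⊆ P[m](L)`), the finite group `G = S ⋊ Aut(L/K)` acts on `Y = P_L = P ×_K Spec L` by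
`K`-automorphisms over `P` via `r = pr ≫ q : Y → P` (`quotAction : ActionOver r G`, packaging
`actionAut` and `actionAut_comp` for the quotient machinery of
`Literature.AlgebraicGeometry.RelativeSpec.FiniteGroupQuotient`). The main result of this file is
that this action is **free** in the scheme-theoretic sense required by Chase–Harrison–Rosenberg
(`quotAction_free`): for `g ≠ 1` and `U ⊆ P` affine open, the `act g b - b` generate the unit
ideal of `Γ(Y, r⁻¹U)`. Two cases:

* `g = (s, σ)` with `σ ≠ 1` (`span_act_sub_eq_top_of_right_ne_one`): for a scalar `c ∈ L` with
  `σ c ≠ c`, the function `(σ c - c)_Y = act g (c_Y) - c_Y` (`scalarSection`,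
  `act_scalarSection`) is a unit;
* `g = (s, 1)` with `s ≠ 1` (`span_act_sub_eq_top_of_right_eq_one`): were the ideal proper, a
  maximal ideal `𝔪` above it would give a `Γ/𝔪`-valued point of `r⁻¹U ⊆ Y` fixed by the
  translation `t_{s⁻¹}`; but a point of `P_L` with values in a field, fixed by a translation
  `t_t`, forces `t = 1` (`eq_one_of_comp_transl_eq`: on `T`-points `t_t` is multiplication by
  the constant point at `t`, and `Spec (Γ/𝔪) → Spec L` is an epimorphism,
  `epi_of_hom_spec_field`) — no Nullstellensatz is needed.

Hence (`Literature.AlgebraicGeometry.RelativeSpec.FreeQuotient`) the quotient map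
`Y → Y/G` is finite, flat and surjective and its fibres on field-valued points are `G`-orbits;
`Y/G` is the quotient abelian variety `P/S` (sequel). Mumford, *Abelian Varieties*, §7, Thm. 4
(p. 72) with the Theorem on p. 66, §12; Görtz–Wedhorn II, Thm. 27.68.

## References

* [MumfordAV1970] D. Mumford, *Abelian Varieties* (1970), §7 (Thm. p. 66, Thm. 4 p. 72), §12.
* [GortzWedhorn2023] U. Görtz, T. Wedhorn, *Algebraic Geometry II* (2023), Def. 27.1, Thm. 27.68.
-/

noncomputable section

universe u

open CategoryTheory CategoryTheory.Limits AlgebraicGeometry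

namespace Literature.AlgebraicGeometry.Motives

namespace AbelianVariety

open scoped MonObj Obj
open Literature.AlgebraicGeometry.RelativeSpec

variable {K : Type u} [Field K] (L : Type u) [Field L] [Algebra K L] (P : AbelianVariety K)

/-! ### Fixed points of translations -/

/-- On `T`-points, the translation `t_Q` of an abelian variety `A` is left multiplication by the
constant point at `Q`: `g ≫ t_Q = (g ≫ (A → Spec k) ≫ Q) · g` (Görtz–Wedhorn II, Def. 27.1;
Mathlib `MonObj.comp_mul`). [cite: GortzWedhorn2023, Def. 27.1 (p. 799)] -/
theorem comp_translation_eq {k : Type u} [Field k] (A : AbelianVariety k) {T : SchemeOver k}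
    (g : T ⟶ A.X) (Q : A.Points k) :
    g ≫ A.translation Q = (g ≫ toSpecOver A.X ≫ Q) * g := by
  unfold translation
  rw [MonObj.comp_mul, Category.comp_id]

/-- **Translations by `t ≠ 1` have no fixed points**: if a `T`-valued point `x` of `Y = P_L`
with `x ≫ pr₂ : T → Spec L` an epimorphism (e.g. `T` the spectrum of a field) is fixed by the
translation `t_t`, then `t = 1` — on `T`-points `t_t` is multiplication by the constant point
at `t`, which is then trivial, and `T → Spec L` is an epimorphism. [folklore] -/
theorem eq_one_of_comp_transl_eq {T : Scheme.{u}} (x : T ⟶ P.bcLeft L) (t : P.Points L)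
    (h : x ≫ P.transl L t = x) [Epi (x ≫ pullback.snd P.X.hom (bcSpec K L))] : t = 1 := by
  -- `x` as a `T`-point of `P_L` over `L`
  let T' : SchemeOver L := Over.mk (x ≫ pullback.snd P.X.hom (bcSpec K L))
  let x' : T' ⟶ (P.baseChange L).X := Over.homMk x rfl
  have h1 : x' ≫ (P.baseChange L).translation (P.pointsMulEquiv L t) = x' :=
    Over.OverMorphism.ext h
  rw [comp_translation_eq] at h1
  -- so the constant point `T' → Spec L →ᵗ P_L` is trivial
  have h2 : x' ≫ toSpecOver (P.baseChange L).X ≫ P.pointsMulEquiv L t = 1 :=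
    mul_right_cancel (h1.trans (one_mul x').symm)
  have h3 : x' ≫ toSpecOver (P.baseChange L).X = toSpecOver T' := Over.OverMorphism.ext rfl
  rw [← Category.assoc, h3] at h2
  -- `T' → Spec L` is an epimorphism, hence `t_L = 1`
  have : Epi (toSpecOver T') := by
    have : Epi (toSpecOver T').left := by
      change Epi (x ≫ pullback.snd P.X.hom (bcSpec K L))
      infer_instance
    exact Over.epi_of_epi_left _
  have h4 : P.pointsMulEquiv L t = 1 := by
    rw [← cancel_epi (toSpecOver T'), h2]
    exact (MonObj.comp_one _).symm
  exact (MulEquiv.map_eq_one_iff (P.pointsMulEquiv L)).mp h4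

/-- A morphism from the spectrum of a nonzero ring to the spectrum of a field is an epimorphism
of schemes (it is flat, the ring being free over the field, and surjective; Mathlib
`epi_of_flat_of_surjective`). [folklore] -/
theorem epi_of_hom_spec_field {F Ω : Type u} [Field F] [CommRing Ω] [Nontrivial Ω]
    (f : Spec (.of Ω) ⟶ Spec (.of F)) : Epi f := by
  obtain ⟨φ, rfl⟩ : ∃ φ : CommRingCat.of F ⟶ .of Ω, Spec.map φ = f := ⟨_, Spec.map_preimage f⟩
  haveI hflat : Flat (Spec.map φ) := by
    rw [HasRingHomProperty.Spec_iff (P := @Flat)]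
    letI := φ.hom.toAlgebra
    change Module.Flat F Ω
    infer_instance
  haveI hsurj : Surjective (Spec.map φ) :=
    ⟨fun p ↦ ⟨Classical.arbitrary _, Subsingleton.elim _ _⟩⟩
  exact Flat.epi_of_flat_of_surjective _

/-! ### The action of `S ⋊ Aut(L/K)` over `P` -/

section Action

variable (S : Subgroup (P.Points L))
  (hS : ∀ (σ : L ≃ₐ[K] L) (s : P.Points L), s ∈ S → σ • s ∈ S)
  (q : P ⟶ P) (hSq : ∀ s ∈ S, s ≫ q.hom.hom.hom = 1)

/-- The structure morphism `r = pr ≫ q : Y = P_L → P` over which `S ⋊ Aut(L/K)` acts: the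
projection followed by a homomorphism `q` killing `S` (an isogeny in the application, e.g.
`q = [m]`, `S ⊆ P[m](L)`). [folklore] -/
abbrev quotR : P.bcLeft L ⟶ P.X.left :=
  pullback.fst P.X.hom (bcSpec K L) ≫ Hom.toSchemeHom q

/-- **The action of `G = S ⋊ Aut(L/K)` on `Y = P_L` over `P`** (via `r = pr ≫ q`), as an
`ActionOver` (`Literature.AlgebraicGeometry.RelativeSpec.FiniteGroupQuotient`): the quotient
`Y / G` will be `P / S` (Mumford, *Abelian Varieties*, §7, Thm. 4, p. 72, built from the Theorem
on p. 66; Görtz–Wedhorn II, Thm. 27.68). [folklore] -/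
def quotAction : ActionOver (P.quotR L q) (S ⋊[P.galMulAut L S hS] (L ≃ₐ[K] L)) where
  aut := P.actionAut L S hS
  aut_comp g := P.actionAut_comp L S hS q hSq g

/-- The automorphism of `Y` by which `g = (s, σ)` acts: `gal σ ≫ transl s`. [folklore] -/
theorem quotAction_aut_hom (g : S ⋊[P.galMulAut L S hS] (L ≃ₐ[K] L)) :
    ((P.quotAction L S hS q hSq).aut g).hom = P.gal L g.right ≫ P.transl L g.left := rfl

/-- The inverse action followed by `pr₂`: `(aut g⁻¹) ≫ pr₂ = pr₂ ≫ Spec(σ)` for `g = (s, σ)`.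
[folklore] -/
theorem quotAction_aut_inv_hom_snd (g : S ⋊[P.galMulAut L S hS] (L ≃ₐ[K] L)) :
    ((P.quotAction L S hS q hSq).aut g⁻¹).hom ≫ pullback.snd P.X.hom (bcSpec K L) =
      pullback.snd P.X.hom (bcSpec K L) ≫
        Spec.map (CommRingCat.ofHom ((g.right : L ≃ₐ[K] L) : L →+* L)) := by
  rw [quotAction_aut_hom, Category.assoc, transl_snd, gal_snd, SemidirectProduct.inv_right,
    inv_inv]

/-! ### Freeness, I: Galois elements move the scalars -/

/-- The scalar `c ∈ L` as a function on `r⁻¹U ⊆ Y` (pulled back from `Spec L` along `pr₂` and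
restricted). [folklore] -/
def scalarSection (U : P.X.left.Opens) : L →+* Γ(P.bcLeft L, P.quotR L q ⁻¹ᵁ U) :=
  ((P.bcLeft L).presheaf.map (homOfLE (le_top (a := P.quotR L q ⁻¹ᵁ U))).op).hom.comp
    ((pullback.snd P.X.hom (bcSpec K L)).appTop.hom.comp (Scheme.ΓSpecIso (.of L)).inv.hom)

/-- **A group element `g = (s, σ)` acts on the scalar functions through `σ`**:
`act g (c_Y) = (σ c)_Y` (translations are `L`-morphisms, and `gal σ` is `1 × Spec(σ⁻¹)`).
[folklore] -/
theorem act_scalarSection (U : P.X.left.Opens) (g : S ⋊[P.galMulAut L S hS] (L ≃ₐ[K] L))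
    (c : L) :
    (P.quotAction L S hS q hSq).act g U (P.scalarSection L q U c) =
      P.scalarSection L q U (g.right c) := by
  change (P.quotAction L S hS q hSq).act g U ((P.bcLeft L).presheaf.map _
      ((pullback.snd P.X.hom (bcSpec K L)).appTop ((Scheme.ΓSpecIso (.of L)).inv c))) =
    (P.bcLeft L).presheaf.map _ ((pullback.snd P.X.hom (bcSpec K L)).appTop
      ((Scheme.ΓSpecIso (.of L)).inv (g.right c)))
  rw [ActionOver.act_map_le_top]
  congr 1
  have h1 := P.quotAction_aut_inv_hom_snd L S hS q hSq g
  have h2 : ((P.quotAction L S hS q hSq).aut g⁻¹).hom.appTop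
      ((pullback.snd P.X.hom (bcSpec K L)).appTop ((Scheme.ΓSpecIso (.of L)).inv c)) =
      (((P.quotAction L S hS q hSq).aut g⁻¹).hom ≫ pullback.snd P.X.hom (bcSpec K L)).appTop
        ((Scheme.ΓSpecIso (.of L)).inv c) := by
    rw [Scheme.Hom.comp_appTop, CommRingCat.comp_apply]
  rw [h2, h1, Scheme.Hom.comp_appTop, CommRingCat.comp_apply]
  congr 1
  -- `(Spec σ)♯ c = σ c` on global sections of `Spec L`
  have h3 := congr($(Scheme.ΓSpecIso_inv_naturality
    (CommRingCat.ofHom ((g.right : L ≃ₐ[K] L) : L →+* L))).hom c)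
  rw [CommRingCat.comp_apply, CommRingCat.comp_apply] at h3
  exact h3.symm

/-- **Freeness for `σ ≠ 1`**: if the Galois component of `g` is non-trivial, the `act g b - b`
generate the unit ideal of `Γ(Y, r⁻¹U)` — for `c ∈ L` with `σ c ≠ c` the scalar function
`(σ c - c)_Y = act g (c_Y) - c_Y` is a unit. [folklore] -/
theorem span_act_sub_eq_top_of_right_ne_one (U : P.X.left.Opens)
    (g : S ⋊[P.galMulAut L S hS] (L ≃ₐ[K] L)) (hg : g.right ≠ 1) :
    Ideal.span (Set.range fun b : Γ(P.bcLeft L, P.quotR L q ⁻¹ᵁ U) ↦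
      (P.quotAction L S hS q hSq).act g U b - b) = ⊤ := by
  obtain ⟨c, hc⟩ : ∃ c : L, g.right c ≠ c :=
    not_forall.mp fun h ↦ hg (AlgEquiv.ext h)
  refine Ideal.eq_top_of_isUnit_mem _ (Ideal.subset_span ⟨P.scalarSection L q U c, rfl⟩) ?_
  change IsUnit ((P.quotAction L S hS q hSq).act g U (P.scalarSection L q U c) -
    P.scalarSection L q U c)
  rw [act_scalarSection, ← map_sub]
  exact (sub_ne_zero.mpr hc).isUnit.map _

/-! ### Freeness, II: non-trivial translations have no fixed points -/

variable [IsAffineHom (Hom.toSchemeHom q)]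

/-- `r = pr ≫ q` is affine when `q` is (e.g. an isogeny). [folklore] -/
instance isAffineHom_quotR : IsAffineHom (P.quotR L q) := by
  have : IsAffineHom (pullback.fst P.X.hom (bcSpec K L)) :=
    MorphismProperty.pullback_fst _ _ inferInstance
  exact MorphismProperty.comp_mem _ _ _ this ‹_›

/-- **Freeness for `σ = 1`, `s ≠ 1`**: if `g = (s, 1)` with `s ≠ 1`, the `act g b - b` generate
the unit ideal of `Γ(Y, r⁻¹U)`, `U ⊆ P` affine open. Otherwise they lie in a maximal ideal `𝔪`,
and the `Γ(Y, r⁻¹U)/𝔪`-valued point `Spec (Γ/𝔪) → Spec Γ(Y, r⁻¹U) ≅ r⁻¹U ⊆ Y` is fixed by the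
translation `t_{s⁻¹}`, which forces `s = 1` (`eq_one_of_comp_transl_eq`; the structure map
`Spec (Γ/𝔪) → Spec L` is an epimorphism). [folklore] -/
theorem span_act_sub_eq_top_of_right_eq_one (U : P.X.left.affineOpens)
    (g : S ⋊[P.galMulAut L S hS] (L ≃ₐ[K] L)) (hg : g.right = 1) (hg' : g ≠ 1) :
    Ideal.span (Set.range fun b : Γ(P.bcLeft L, P.quotR L q ⁻¹ᵁ U) ↦
      (P.quotAction L S hS q hSq).act g U b - b) = ⊤ := by
  set ρ := P.quotAction L S hS q hSq with hρ
  by_contra hne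
  obtain ⟨𝔪, h𝔪, hle⟩ := Ideal.exists_le_maximal _ hne
  have hV : IsAffineOpen (P.quotR L q ⁻¹ᵁ U.1) := U.2.preimage _
  -- the quotient field and the point
  let ψ : Γ(P.bcLeft L, P.quotR L q ⁻¹ᵁ U.1) →+* Γ(P.bcLeft L, P.quotR L q ⁻¹ᵁ U.1) ⧸ 𝔪 :=
    Ideal.Quotient.mk 𝔪
  have hψ : ψ.comp (ρ.act g U.1) = ψ := by
    ext b
    exact (Ideal.Quotient.eq.mpr (hle (Ideal.subset_span ⟨b, rfl⟩)))
  haveI : Nontrivial (Γ(P.bcLeft L, P.quotR L q ⁻¹ᵁ U.1) ⧸ 𝔪) :=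
    Ideal.Quotient.nontrivial_iff.mpr h𝔪.ne_top
  let x : Spec (.of (Γ(P.bcLeft L, P.quotR L q ⁻¹ᵁ U.1) ⧸ 𝔪)) ⟶ P.bcLeft L :=
    Spec.map (CommRingCat.ofHom ψ) ≫ hV.isoSpec.inv ≫ (P.quotR L q ⁻¹ᵁ U.1).ι
  -- it is fixed by `aut g⁻¹ = t_{(g⁻¹).1}`
  have hx : x ≫ (ρ.aut g⁻¹).hom = x := by
    change (Spec.map (CommRingCat.ofHom ψ) ≫ hV.isoSpec.inv ≫ (P.quotR L q ⁻¹ᵁ U.1).ι) ≫ _ =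
      Spec.map (CommRingCat.ofHom ψ) ≫ hV.isoSpec.inv ≫ (P.quotR L q ⁻¹ᵁ U.1).ι
    rw [Category.assoc, Category.assoc, ← ρ.specMap_act_comp_ι g U.1 hV,
      ← Spec.map_comp_assoc, ← CommRingCat.ofHom_comp, hψ]
  have hx' : x ≫ P.transl L ((g⁻¹).left : P.Points L) = x := by
    have e : (ρ.aut g⁻¹).hom = P.transl L ((g⁻¹).left : P.Points L) := by
      rw [hρ, quotAction_aut_hom, SemidirectProduct.inv_right, hg, inv_one, gal_one,
        Category.id_comp]
    rwa [e] at hx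
  -- hence `(g⁻¹).1 = 1`, so `g = 1`
  haveI : Epi (x ≫ pullback.snd P.X.hom (bcSpec K L)) := epi_of_hom_spec_field _
  have h1 : ((g⁻¹).left : P.Points L) = 1 := P.eq_one_of_comp_transl_eq L x _ hx'
  apply hg'
  rw [← inv_eq_one]
  refine SemidirectProduct.ext ?_ ?_
  · exact Subtype.ext h1
  · rw [SemidirectProduct.inv_right, hg, inv_one, SemidirectProduct.one_right]

/-- **The action of `S ⋊ Aut(L/K)` on `Y = P_L` over `P` is free**: for every `g ≠ 1` and every
affine open `U ⊆ P`, the `act g b - b` generate the unit ideal of `Γ(Y, r⁻¹U)` (so that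
Chase–Harrison–Rosenberg applies on each chart, `Literature.AlgebraicGeometry.RelativeSpec.FreeQuotient`).
[folklore] -/
theorem quotAction_free (U : P.X.left.affineOpens) (g : S ⋊[P.galMulAut L S hS] (L ≃ₐ[K] L))
    (hg : g ≠ 1) :
    Ideal.span (Set.range fun b : Γ(P.bcLeft L, P.quotR L q ⁻¹ᵁ U) ↦
      (P.quotAction L S hS q hSq).act g U b - b) = ⊤ := by
  by_cases h : g.right = 1
  · exact P.span_act_sub_eq_top_of_right_eq_one L S hS q hSq U g h hg
  · exact P.span_act_sub_eq_top_of_right_ne_one L S hS q hSq U.1 g h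

end Action

end AbelianVariety

end Literature.AlgebraicGeometry.Motives
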